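import Summits.Ventures.Crystal3D.Bulk.BandedAccounting
import HarnessLib

/-!
# Banded (occupancy) accounting, part 2: multiplicities, the bound functional `Φ`, abstract certificate soundness

HONEST FRAMING. Part of the venture `Summits/Ventures/Crystal3D` (cell `pub-crystal3d`, phase 2, decision sprint).
Mathematics and Lean text by seat theory-1 (g7) (scratch `HOME/lean/occframe/spec/BandedAccounting.scratch.lean.txt`,
sha256:16 `5a20ba3435f60bb9`, farm rc 0 / 0 sorry / standard axioms), LANDED UNCHANGED (second half of the split) by seat
p1 (g7) under lead g7 RULING #4 (g7) (1)(b). LANE-INDEPENDENT INFRASTRUCTURE; certifies nothing about any level; the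
occupancy glue stays out of the tree until a box 1 exists (RULING #132 (c)).

Content (namespace `Summit.Ventures.Crystal3D.BandedSpec`), continuing `Bulk/BandedAccounting.lean`:
* `bandCount C lab p` = `#(C ∩ lab⁻¹ p)` (as a real), `sum_lab_fiberwise`, `card_filter_erase_real`;
* `triple_multiplicity` **(C, triples)**: `Σ_{x,y,z distinct} f (lab x) (lab y) (lab z)
  = Σ_p n_p Σ_q (n_q − [p=q]) Σ_r (n_r − [p=r] − [q=r]) f p q r`;
* `phi n d c t` — the certificate's bound functional `Φ(n)`; `pair_multiplicity'`;
* `readings_le_phi` **(B-shape)**: point-level piece bounds ⇒ total readings `≤ Φ(bandCount)`;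
* `occupancy_certificate_sound`: for FACTORED data (positivity supplied by `banded_accounting_factored`), the piece
  bounds and `Φ(bandCount C lab) < 0` give `False`.
What a KERNEL occupancy socket still needs (successor typer, AFTER a box 1): the per-certificate (I)(II)(III) interval
modules proving the piece bounds on the closed band boxes (+ the (T1) t-range step), and the dictionary from a `Fin 12`
hole configuration to `(C, lab, bandCount)` ⇒ `OccCut` (theory-1's `OccFrame`).
-/

open Finset
open scoped InnerProductSpace BigOperators

namespace Summit.Ventures.Crystal3D.BandedSpec

variable {K : ℕ}

/-! ## (C) Multiplicity arithmetic, triples; band counts -/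

/-- The number of points of `C` carrying label `p` (as a real number). -/
noncomputable def bandCount (C : Finset (EuclideanSpace ℝ (Fin 3)))
    (lab : EuclideanSpace ℝ (Fin 3) → Fin K) (p : Fin K) : ℝ :=
  ((C.filter fun x => lab x = p).card : ℝ)

/-- Fiberwise summation of a label function over any finite point set. -/
theorem sum_lab_fiberwise (D : Finset (EuclideanSpace ℝ (Fin 3)))
    (lab : EuclideanSpace ℝ (Fin 3) → Fin K) (F : Fin K → ℝ) :
    (∑ x ∈ D, F (lab x)) = ∑ p : Fin K, ((D.filter fun x => lab x = p).card : ℝ) * F p := by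
  classical
  rw [← Finset.sum_fiberwise_of_maps_to (s := D) (t := Finset.univ) (g := lab)
    (f := fun x => F (lab x)) (fun x _ => Finset.mem_univ (lab x))]
  refine Finset.sum_congr rfl fun p _ => ?_
  have hc : ∀ x ∈ D.filter (fun x => lab x = p), F (lab x) = F p := fun x hx => by
    rw [(Finset.mem_filter.mp hx).2]
  rw [Finset.sum_congr rfl hc, Finset.sum_const, nsmul_eq_mul]

/-- Erasing a member lowers a fiber count by the indicator of its label. -/
theorem card_filter_erase_real (s : Finset (EuclideanSpace ℝ (Fin 3))) (a : EuclideanSpace ℝ (Fin 3))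
    (ha : a ∈ s) (P : EuclideanSpace ℝ (Fin 3) → Prop) [DecidablePred P] :
    (((s.erase a).filter P).card : ℝ) = ((s.filter P).card : ℝ) - (if P a then 1 else 0) := by
  classical
  rw [Finset.filter_erase]
  split_ifs with h
  · have hm : a ∈ s.filter P := Finset.mem_filter.mpr ⟨ha, h⟩
    have h1 := Finset.card_erase_add_one hm
    have h2 : ((((s.filter P).erase a).card : ℕ) : ℝ) + 1 = ((s.filter P).card : ℝ) := by
      exact_mod_cast h1
    linarith
  · rw [Finset.erase_eq_of_notMem (fun hm => h (Finset.mem_filter.mp hm).2)]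
    simp

/-- **(C) Multiplicity arithmetic, triples**: with `n = bandCount C lab`,
`Σ_{x,y,z distinct} f (lab x) (lab y) (lab z)
   = Σ_p n_p · Σ_q (n_q − [p=q]) · Σ_r (n_r − [p=r] − [q=r]) · f p q r`
(choose `x` in band `p`, then `y ≠ x` in band `q`, then `z ≠ x, y` in band `r`). -/
theorem triple_multiplicity (C : Finset (EuclideanSpace ℝ (Fin 3)))
    (lab : EuclideanSpace ℝ (Fin 3) → Fin K) (f : Fin K → Fin K → Fin K → ℝ) :
    (∑ x ∈ C, ∑ y ∈ C.erase x, ∑ z ∈ (C.erase x).erase y, f (lab x) (lab y) (lab z))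
      = ∑ p : Fin K, bandCount C lab p *
          ∑ q : Fin K, (bandCount C lab q - (if p = q then 1 else 0)) *
            ∑ r : Fin K, (bandCount C lab r - (if p = r then 1 else 0) - (if q = r then 1 else 0))
              * f p q r := by
  classical
  -- fiber counts after one and two erasures
  have cy : ∀ x ∈ C, ∀ q : Fin K,
      (((C.erase x).filter fun y => lab y = q).card : ℝ) = bandCount C lab q - (if lab x = q then 1 else 0) := by
    intro x hx q
    rw [card_filter_erase_real C x hx]; rfl
  have cz : ∀ x ∈ C, ∀ y ∈ C.erase x, ∀ r : Fin K,
      ((((C.erase x).erase y).filter fun z => lab z = r).card : ℝ)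
        = bandCount C lab r - (if lab x = r then 1 else 0) - (if lab y = r then 1 else 0) := by
    intro x hx y hy r
    rw [card_filter_erase_real (C.erase x) y hy, cy x hx r]
  -- innermost sum (over z)
  have hz : ∀ x ∈ C, ∀ y ∈ C.erase x,
      (∑ z ∈ (C.erase x).erase y, f (lab x) (lab y) (lab z))
        = ∑ r : Fin K, (bandCount C lab r - (if lab x = r then 1 else 0) - (if lab y = r then 1 else 0))
            * f (lab x) (lab y) r := by
    intro x hx y hy
    rw [sum_lab_fiberwise ((C.erase x).erase y) lab (f (lab x) (lab y))]
    exact Finset.sum_congr rfl fun r _ => by rw [cz x hx y hy r]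
  -- middle sum (over y)
  have hy : ∀ x ∈ C,
      (∑ y ∈ C.erase x, ∑ z ∈ (C.erase x).erase y, f (lab x) (lab y) (lab z))
        = ∑ q : Fin K, (bandCount C lab q - (if lab x = q then 1 else 0)) *
            ∑ r : Fin K, (bandCount C lab r - (if lab x = r then 1 else 0) - (if q = r then 1 else 0))
              * f (lab x) q r := by
    intro x hx
    rw [Finset.sum_congr rfl (fun y hy' => hz x hx y hy')]
    rw [sum_lab_fiberwise (C.erase x) lab (fun q => ∑ r : Fin K,
      (bandCount C lab r - (if lab x = r then 1 else 0) - (if q = r then 1 else 0)) * f (lab x) q r)]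
    exact Finset.sum_congr rfl fun q _ => by rw [cy x hx q]
  -- outer sum (over x)
  rw [Finset.sum_congr rfl (fun x hx => hy x hx)]
  rw [sum_lab_fiberwise C lab (fun p => ∑ q : Fin K, (bandCount C lab q - (if p = q then 1 else 0)) *
      ∑ r : Fin K, (bandCount C lab r - (if p = r then 1 else 0) - (if q = r then 1 else 0)) * f p q r)]
  rfl

/-! ## The bound functional Φ(n) and the abstract soundness of a banded (occupancy) certificate -/

/-- The certificate's bound functional: with band counts `n`, one-point bounds `d`, pair bounds `c`
and triple bounds `t` (the (I)(II)(III) piece bounds on the CLOSED band boxes),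
`Φ(n) = Σ_p n_p d_p + Σ_pq (n_p n_q − [p=q] n_p) c_pq + Σ_p n_p Σ_q (n_q − [p=q]) Σ_r (n_r − [p=r] − [q=r]) t_pqr`. -/
noncomputable def phi (n : Fin K → ℝ) (d : Fin K → ℝ) (c : Fin K → Fin K → ℝ)
    (t : Fin K → Fin K → Fin K → ℝ) : ℝ :=
  (∑ p : Fin K, n p * d p)
  + (∑ p : Fin K, ∑ q : Fin K, (n p * n q - (if p = q then n p else 0)) * c p q)
  + ∑ p : Fin K, n p * ∑ q : Fin K, (n q - (if p = q then 1 else 0)) *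
      ∑ r : Fin K, (n r - (if p = r then 1 else 0) - (if q = r then 1 else 0)) * t p q r

/-- `pair_multiplicity` in `bandCount` notation. -/
theorem pair_multiplicity' (C : Finset (EuclideanSpace ℝ (Fin 3)))
    (lab : EuclideanSpace ℝ (Fin 3) → Fin K) (c : Fin K → Fin K → ℝ) :
    (∑ x ∈ C, ∑ y ∈ C.erase x, c (lab x) (lab y))
      = ∑ p : Fin K, ∑ q : Fin K,
          (bandCount C lab p * bandCount C lab q - (if p = q then bandCount C lab p else 0)) * c p q := by
  unfold bandCount; exact pair_multiplicity C lab c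

/-- **(B) ⇒ readings ≤ Φ(n).**  If every one-point / ordered-pair / ordered-triple reading of points of
`C` is bounded by the piece bound of its label tuple, the total of the readings is at most `Φ(bandCount)`. -/
theorem readings_le_phi (Kp : ℝ → ℝ → ℝ → ℝ)
    (S : Fin K → Option (Fin K) → Option (Fin K) → ℝ → ℝ → ℝ → ℝ)
    (e : EuclideanSpace ℝ (Fin 3)) (C : Finset (EuclideanSpace ℝ (Fin 3)))
    (lab : EuclideanSpace ℝ (Fin 3) → Fin K)
    (d : Fin K → ℝ) (c : Fin K → Fin K → ℝ) (t : Fin K → Fin K → Fin K → ℝ)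
    (hD : ∀ x ∈ C, readD Kp S (lab x) ⟪e, x⟫_ℝ ≤ d (lab x))
    (hPh : ∀ x ∈ C, ∀ y ∈ C, x ≠ y →
      readPh Kp S (lab x) (lab y) ⟪e, x⟫_ℝ ⟪e, y⟫_ℝ ⟪x, y⟫_ℝ ≤ c (lab x) (lab y))
    (hT : ∀ x ∈ C, ∀ y ∈ C, ∀ z ∈ C, x ≠ y → x ≠ z → y ≠ z →
      readT S (lab x) (lab y) (lab z) ⟪x, y⟫_ℝ ⟪x, z⟫_ℝ ⟪y, z⟫_ℝ ≤ t (lab x) (lab y) (lab z)) :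
    (∑ x ∈ C, readD Kp S (lab x) ⟪e, x⟫_ℝ)
      + (∑ x ∈ C, ∑ y ∈ C.erase x, readPh Kp S (lab x) (lab y) ⟪e, x⟫_ℝ ⟪e, y⟫_ℝ ⟪x, y⟫_ℝ)
      + (∑ x ∈ C, ∑ y ∈ C.erase x, ∑ z ∈ (C.erase x).erase y,
          readT S (lab x) (lab y) (lab z) ⟪x, y⟫_ℝ ⟪x, z⟫_ℝ ⟪y, z⟫_ℝ)
      ≤ phi (bandCount C lab) d c t := by
  classical
  have h1 : (∑ x ∈ C, readD Kp S (lab x) ⟪e, x⟫_ℝ) ≤ ∑ x ∈ C, d (lab x) :=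
    Finset.sum_le_sum hD
  have h2 : (∑ x ∈ C, ∑ y ∈ C.erase x, readPh Kp S (lab x) (lab y) ⟪e, x⟫_ℝ ⟪e, y⟫_ℝ ⟪x, y⟫_ℝ)
      ≤ ∑ x ∈ C, ∑ y ∈ C.erase x, c (lab x) (lab y) :=
    Finset.sum_le_sum fun x hx => Finset.sum_le_sum fun y hy =>
      hPh x hx y (Finset.mem_of_mem_erase hy) (Finset.ne_of_mem_erase hy).symm
  have h3 : (∑ x ∈ C, ∑ y ∈ C.erase x, ∑ z ∈ (C.erase x).erase y,
        readT S (lab x) (lab y) (lab z) ⟪x, y⟫_ℝ ⟪x, z⟫_ℝ ⟪y, z⟫_ℝ)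
      ≤ ∑ x ∈ C, ∑ y ∈ C.erase x, ∑ z ∈ (C.erase x).erase y, t (lab x) (lab y) (lab z) :=
    Finset.sum_le_sum fun x hx => Finset.sum_le_sum fun y hy => Finset.sum_le_sum fun z hz =>
      hT x hx y (Finset.mem_of_mem_erase hy) z
        (Finset.mem_of_mem_erase (Finset.mem_of_mem_erase hz))
        (Finset.ne_of_mem_erase hy).symm
        (Finset.ne_of_mem_erase (Finset.mem_of_mem_erase hz)).symm
        (Finset.ne_of_mem_erase hz).symm
  calc _ ≤ (∑ x ∈ C, d (lab x)) + (∑ x ∈ C, ∑ y ∈ C.erase x, c (lab x) (lab y))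
        + ∑ x ∈ C, ∑ y ∈ C.erase x, ∑ z ∈ (C.erase x).erase y, t (lab x) (lab y) (lab z) :=
      add_le_add (add_le_add h1 h2) h3
    _ = phi (bandCount C lab) d c t := by
      rw [sum_lab_fiberwise C lab d, pair_multiplicity' C lab c, triple_multiplicity C lab t]
      rfl

/-- **Abstract soundness of a banded occupancy certificate (factored data).**  If the piece bounds
(B) hold for the labelling `lab` and the certificate's bound functional is negative at the realised
band counts, `Φ(bandCount C lab) < 0`, then there is no such point set: `False`.  With
`banded_accounting_factored` supplying `0 ≤ readings`, nothing about positivity is assumed. -/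
theorem occupancy_certificate_sound (Kc Rc Kq R : ℕ) (g : ℕ → ℕ → ℝ → ℝ)
    (a : Fin K → Option (Fin K) → ℕ → ℕ → ℝ → ℝ)
    (e : EuclideanSpace ℝ (Fin 3)) (he : ‖e‖ = 1)
    (C : Finset (EuclideanSpace ℝ (Fin 3))) (hC : ∀ x ∈ C, ‖x‖ = 1)
    (lab : EuclideanSpace ℝ (Fin 3) → Fin K)
    (d : Fin K → ℝ) (c : Fin K → Fin K → ℝ) (t : Fin K → Fin K → Fin K → ℝ)
    (hD : ∀ x ∈ C, readD (Literature.Geometry.DiscreteGeometry.BachocVallentin.capKernel3 Kc Rc g)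
      (fun b β β' => Summit.Ventures.Crystal3D.CapX2.poleKernel3 Kq R (a b β) (a b β')) (lab x) ⟪e, x⟫_ℝ
        ≤ d (lab x))
    (hPh : ∀ x ∈ C, ∀ y ∈ C, x ≠ y →
      readPh (Literature.Geometry.DiscreteGeometry.BachocVallentin.capKernel3 Kc Rc g)
        (fun b β β' => Summit.Ventures.Crystal3D.CapX2.poleKernel3 Kq R (a b β) (a b β'))
        (lab x) (lab y) ⟪e, x⟫_ℝ ⟪e, y⟫_ℝ ⟪x, y⟫_ℝ ≤ c (lab x) (lab y))
    (hT : ∀ x ∈ C, ∀ y ∈ C, ∀ z ∈ C, x ≠ y → x ≠ z → y ≠ z →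
      readT (fun b β β' => Summit.Ventures.Crystal3D.CapX2.poleKernel3 Kq R (a b β) (a b β'))
        (lab x) (lab y) (lab z) ⟪x, y⟫_ℝ ⟪x, z⟫_ℝ ⟪y, z⟫_ℝ ≤ t (lab x) (lab y) (lab z))
    (hΦ : phi (bandCount C lab) d c t < 0) : False := by
  have hpos := banded_accounting_factored (K := K) Kc Rc Kq R g a e he C hC lab
  have hle := readings_le_phi _ _ e C lab d c t hD hPh hT
  linarith

end Summit.Ventures.Crystal3D.BandedSpec
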